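import Summits.NavierStokesRegularity.NavierStokesRegularity.Theses.TypeICertificateLadder
import Summits.NavierStokesRegularity.NavierStokesRegularity.Theorems.RungReynoldsOne.Negative.BudgetCeiling
import Literature.Analysis.FluidPDE.NSVorticity
import Literature.Analysis.FluidPDE.EnstrophyGronwall
import Literature.Analysis.FluidPDE.TaoLocalisation
import HarnessLib.Audit

/-!
# Line `lp-vorticity-young-budget` — crux `RungReynoldsOne` (stmt-NavierStokesRegularity-2882)

Lead's skeleton (prover-line-stmt-NavierStokesRegularity-2882-0, 2026-08-16) for the crux idea
`Cruxes/RungReynoldsOne/Ideas/ideas-2882-ideator3.md` card 1 (`lp-vorticity-young-budget`; triage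
r1-1/2/3: pass, ranked first; Disproof §(c) `budgetCloses_one_iff`: the `L^q`-vorticity budget
closes rung `X_1` for every `q ∈ (2, 3)`). Two rc0 end-to-end proofs along this line sit in the
item's evidence (2026-08-16T00:13Z / 00:40Z) but are unreadable from the lead's jail, so the line is
re-formalised here with `q = 5/2` and a SMOOTH weight.

## The line in one paragraph

Let `ω = curl u`. With the smooth convex weight `F(y) = (|y|² + 1)^{5/4} − 1 ≥ |y|^{5/2}`,
`∇F(y) = (5/2)(|y|²+1)^{1/4} y`, the vorticity equation `∂ₜω = νΔω − (u·∇)ω + (ω·∇)u` gives, after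
integrating the stretching term by parts ONTO `u` (using `div ω = 0`) and absorbing both pieces by
Young into the two non-negative viscous pieces,
`d/dt ∫F(ω) = (5/2)∫(|ω|²+1)^{1/4}⟪ω, ∂ₜω⟫ ≤ (15/(16ν)) ‖u(t)‖²_∞ ∫F(ω)` (sharp factor
`q(q−1)/4 = 15/16`; stubs S1 slice, S2 balance, S3 slab Grönwall). Under the rung hypothesis
`‖u(t)‖²_∞ ≤ ν/(T−t)` this is the SUBCRITICAL bound `∫|ω(t)|^{5/2} ≤ ∫F(ω(t)) ≲ (T−t)^{-15/16}`.
The enstrophy balance in multiplier form, `∫Σᵢ⟪∂ᵢu,∂ᵢ∂ₜu⟫ = −ν⁻¹(‖∂ₜu‖² + ∫⟪(u·∇)u, ∂ₜu⟫)` with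
the Lamb decomposition `(u·∇)u = ω×u + ∇|u|²/2` (the gradient is invisible to the divergence-free
`∂ₜu`), gives `d/dt‖∇u‖² ≤ (2ν)⁻¹∫|u|²|ω|² ≤ (2ν)⁻¹‖u‖²_{10}‖ω‖²_{5/2}` (Hölder `1/5 + 4/5`; stub
S4), and `‖u‖_{10}² ≤ ‖u‖_∞^{4/5}‖u‖₆^{6/5} ≤ ‖u‖_∞^{4/5}(K_S‖∇u‖₂)^{6/5}` (Sobolev, tree
`eLpNorm_six_le_eLpNorm_fderiv_two`) together with the landed sharp `q = 2` slab inequality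
(`Target.Negative.lintegral_frobeniusNormSq_le_exp_half_linfty`: `‖∇u(t)‖² ≲ (T−t)^{-1/2}`) yields
`‖∇u(t)‖₂² ≲ (T−t)^{-(2/5+3/10+3/4)+1} = (T−t)^{-9/20}` (stub S7, through the Tao-class cover S5).
At a singular time the `H¹` local theory forces `(‖u(t)‖₂² + ‖∇u(t)‖₂²)²(T−t) ≥ cν³` (stub S6;
Tao 2013 Thm 5.4 lifespan, tree `tao2011_smooth_local_existence_holds`; equivalently Leray's `L⁶`
rate `leray_blowup_rate_holds` + Sobolev). Since `9/20 < 1/2` the two are incompatible as `t ↑ T`: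
the solution extends (`rung_one_of_decay_of_rate`, `RungReynoldsOne_of`).

## Stubs (7, registered by `ledger skeleton check`; statements spelled out in tree vocabulary)

* S1 `stub_weightedVorticitySlice` — the weighted `L^{5/2}` slice inequality (one time).
* S2 `stub_weightedVorticityBalance` — `∫F(w(b)) = ∫F(w(0)) + ∫₀ᵇ (5/2)∫(|w|²+1)^{1/4}⟪w, ∂ₜw⟫`
  for a jointly smooth `w` on a closed slab (the weighted twin of `IsSmoothSpaceTimeOn.l2_balance`).
* S3 `stub_weightedVorticitySlab` — S1 → S2 → the slab Grönwall bound with time-dependent sup norm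
  (twin of `Target.Negative.lintegral_frobeniusNormSq_le_exp_half_linfty`, factor `15/(16ν)`).
* S4 `stub_enstrophyLambSlab` — the slab enstrophy inequality with `L^{10} × L^{5/2}` production.
* S5 `stub_taoCover` — a classical Leray–Hopf Schwartz-datum solution on `[0,T)` is in Tao's class
  on every closed sub-slab `[0,T']`, with SOME (Leray-normalised) pressure.
* S6 `stub_h1BlowupRate` — no classical extension past `T` ⇒ `cν³ ≤ (‖u(t)‖₂²+‖∇u(t)‖₂²)²(T−t)`.
* S7 `stub_rateBookkeeping` — S3-conclusion → S4 → S5 → along rate-one solutions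
  `‖u(t)‖₂² + ‖∇u(t)‖₂² ≤ K (T−t)^{-9/20}` near `T` (held by the lead).

## Disproof.lean (gen 2) honoured

* `rungReynoldsOne_false_without_LerayHopf` / `rung_false_with_weak_for_LerayHopf`: the ENERGY
  CLASS is used in S5 (finite energy ⇒ Tao class on closed sub-slabs, Tao 2013 Cor 11.1) and S6
  (the `H¹` lifespan needs `u(t) ∈ H¹`; the drifts `g(t)e₀` have `∇u ≡ 0`, infinite energy, and
  violate exactly S6); `rungReynoldsOne_false_without_classical`: every identity is on smooth slices.
* `budgetCloses_one_iff` / `lt_ceiling_of_budgetCloses` (landed `Negative/BudgetCeiling.lean`,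
  imported): `q = 5/2 ∈ (2,3)`; exponents `15/16 < 1` (vorticity) and `9/20 < 1/2` (enstrophy).
-/

noncomputable section

namespace Summit.NavierStokesRegularity.NavierStokesRegularity.Cruxes.RungReynoldsOne.LpVorticityYoungBudget

open Set Filter Topology MeasureTheory
open scoped RealInnerProductSpace ENNReal NNReal Laplacian ContDiff
open Literature.Analysis.FluidPDE
open Summit.NavierStokesRegularity.NavierStokesRegularity.Theses.TypeICertificateLadder

set_option linter.dupNamespace false

/-! ## The rung template (shape of `LadderGlue` / `Assembly`; `Rung 1 ↔ RungReynoldsOne`) -/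

/-- Rung `X_C` of the ladder, verbatim the antecedent shape of `LadderGlue`. -/
def Rung (C : ℝ) : Prop :=
  ∀ (ν T : ℝ), 0 < ν → 0 < T →
    ∀ (u : ℝ → EuclideanSpace ℝ (Fin 3) → EuclideanSpace ℝ (Fin 3))
      (p : ℝ → EuclideanSpace ℝ (Fin 3) → ℝ),
    IsClassicalNSSolutionOn (Set.Ico 0 T) ν 0 u p → IsLerayHopfOn T ν 0 (u 0) u →
    HasRapidSpatialDecay (u 0) →
    (∀ᶠ t in 𝓝[<] T, ∀ x, Real.sqrt (T - t) * ‖u t x‖ ≤ C * Real.sqrt ν) →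
    HasSmoothExtensionPast ν 0 u T

/-- The crux is literally rung one. -/
theorem rung_one_iff : Rung 1 ↔ RungReynoldsOne := by
  simp only [Rung, RungReynoldsOne, one_mul]

/-! ## Registered stubs (statements spelled out: Theorems files cannot import this file) -/

/-- **S1 — the weighted `L^{5/2}` vorticity slice inequality.** For smooth divergence-free `v`
with `ω = curl v`, bounded with bounded gradient and `D v, D²v, D³v ∈ L²`, and smooth `W` with
`DW ∈ L²` satisfying the vorticity equation `curl W = νΔω − (v·∇)ω + (ω·∇)v` (`W = ∂ₜu` for a
classical solution, tree `IsClassicalNSSolutionOn.curl_timeDerivWithin_eq`):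
`∫ (|ω|²+1)^{1/4}⟪ω, curl W⟫ ≤ (3/(8ν)) ∫ |v|² (|ω|²+1)^{1/4}|ω|²`.
Proof: transport term `= (2/5)∫⟪∇(F∘ω), v⟫ = 0` (`div v = 0`); viscous term
`= −νΣⱼ∫⟪DΦ(ω)∂ⱼω, ∂ⱼω⟫ = −ν∫[(|ω|²+1)^{1/4}|∇ω|² + ½(|ω|²+1)^{-3/4}Σⱼ⟪ω,∂ⱼω⟫²]`
(`Φ(y) = (|y|²+1)^{1/4}y`); stretching `= −∫⟪v, DΦ(ω)[(ω·∇)ω]⟫` (IBP onto `v`, `div ω = 0`);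
two pointwise Young absorptions with the sharp weights give the factor `(1 + ½)/4 = 3/8`. -/
theorem stub_weightedVorticitySlice :
    ∀ ⦃ν : ℝ⦄, 0 < ν →
    ∀ ⦃v W : EuclideanSpace ℝ (Fin 3) → EuclideanSpace ℝ (Fin 3)⦄,
      ContDiff ℝ ∞ v → ContDiff ℝ ∞ W → VectorCalculus.IsDivFree v →
      (∀ x, curl W x = ν • (Δ (curl v)) x - convect v (curl v) x + convect (curl v) v x) →
    ∀ ⦃M B : ℝ⦄, (∀ x, ‖v x‖ ≤ M) → (∀ x, ‖fderiv ℝ v x‖ ≤ B) →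
      (∫⁻ x, ‖iteratedFDeriv ℝ 1 v x‖ₑ ^ 2 < ⊤) → (∫⁻ x, ‖iteratedFDeriv ℝ 2 v x‖ₑ ^ 2 < ⊤) →
      (∫⁻ x, ‖iteratedFDeriv ℝ 3 v x‖ₑ ^ 2 < ⊤) → (∫⁻ x, ‖iteratedFDeriv ℝ 1 W x‖ₑ ^ 2 < ⊤) →
      ∫ x, (‖curl v x‖ ^ 2 + 1) ^ (1 / 4 : ℝ) * ⟪curl v x, curl W x⟫ ≤
        3 / (8 * ν) * ∫ x, ‖v x‖ ^ 2 * ((‖curl v x‖ ^ 2 + 1) ^ (1 / 4 : ℝ) * ‖curl v x‖ ^ 2) := by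
  sorry

/-- **S2 — the weighted balance of a jointly smooth field on a closed slab** (weighted twin of
`IsSmoothSpaceTimeOn.l2_balance`): for `w` jointly smooth on `[0,T] × ℝ³`, bounded, with
`∫‖w(t)‖² ≤ C₀`, `∫‖∂ₜw(t)‖² ≤ C₁` (one-sided time derivative within `[0,T]`), the weighted mass
`Φ(t) = ∫((|w|²+1)^{5/4} − 1)` and its production `Ψ(t) = (5/2)∫(|w|²+1)^{1/4}⟪w, ∂ₜw⟫` satisfy:
`Ψ ∈ L¹(0,T)`, `Φ` continuous on `[0,T]`, `Φ(b) = Φ(0) + ∫₀ᵇ Ψ` (`b ∈ (0,T]`). Pointwise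
`d/dt F(w) = (5/2)(|w|²+1)^{1/4}⟪w,∂ₜw⟫`, domination `|·| ≤ (5/2)(B²+1)^{1/4}|w||∂ₜw|`,
`F(w) ≤ (5/4)(B²+1)^{1/4}|w|²`, FTC in `t` per `x`, Fubini. -/
theorem stub_weightedVorticityBalance :
    ∀ ⦃T : ℝ⦄, 0 < T → ∀ ⦃w : ℝ → EuclideanSpace ℝ (Fin 3) → EuclideanSpace ℝ (Fin 3)⦄,
      IsSmoothSpaceTimeOn (Icc 0 T) w →
    ∀ ⦃C₀ C₁ : ℝ≥0⦄ ⦃B : ℝ⦄,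
      (∀ t ∈ Icc 0 T, ∫⁻ x, ‖w t x‖ₑ ^ 2 ≤ C₀) →
      (∀ t ∈ Icc 0 T, ∫⁻ x, ‖timeDerivWithin (Icc 0 T) w t x‖ₑ ^ 2 ≤ C₁) →
      (∀ t ∈ Icc 0 T, ∀ x, ‖w t x‖ ≤ B) →
      IntegrableOn (fun t => ∫ x, 5 / 2 * ((‖w t x‖ ^ 2 + 1) ^ (1 / 4 : ℝ) *
          ⟪w t x, timeDerivWithin (Icc 0 T) w t x⟫)) (Ioo 0 T) ∧
      ContinuousOn (fun t => ∫ x, ((‖w t x‖ ^ 2 + 1) ^ (5 / 4 : ℝ) - 1)) (Icc 0 T) ∧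
      ∀ b ∈ Ioc 0 T, ∫ x, ((‖w b x‖ ^ 2 + 1) ^ (5 / 4 : ℝ) - 1) =
        (∫ x, ((‖w 0 x‖ ^ 2 + 1) ^ (5 / 4 : ℝ) - 1)) +
          ∫ t in (0 : ℝ)..b, ∫ x, 5 / 2 * ((‖w t x‖ ^ 2 + 1) ^ (1 / 4 : ℝ) *
            ⟪w t x, timeDerivWithin (Icc 0 T) w t x⟫) := by
  sorry

/-- **S3 — the weighted `L^{5/2}` vorticity slab inequality** (from S1 and S2; twin of
`Target.Negative.lintegral_frobeniusNormSq_le_exp_half_linfty` with the enstrophy replaced by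
`∫F(curl u)` and `(2ν)⁻¹` by `15/(16ν)`): for a classical solution on `[0,T] × ℝ³` in Tao's class
(`u`, `∂ₜu`, `p` with all `L²` Sobolev norms bounded) and `s ∈ (0,T]` with `∫₀ˢ‖u‖²_∞ < ∞`,
`∫F(ω(s)) ≤ exp((15/(16ν))∫₀ˢ‖u(t)‖²_∞ dt) ∫F(ω(0))`. Proof: S2 for `w = vorticity u`
(`IsSmoothSpaceTimeOn.isSmoothSpaceTimeOn_vorticity`, `curl_timeDerivWithin_of_uniqueDiffOn`), S1 at
interior times with `IsClassicalNSSolutionOn.curl_timeDerivWithin_eq`, the pointwise bounds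
`‖u t x‖ ≤ ‖u t‖_∞` and `(|y|²+1)^{1/4}|y|² ≤ F(y)`, Grönwall `lintegral_gronwall_le`. -/
theorem stub_weightedVorticitySlab :
    (∀ ⦃ν : ℝ⦄, 0 < ν →
    ∀ ⦃v W : EuclideanSpace ℝ (Fin 3) → EuclideanSpace ℝ (Fin 3)⦄,
      ContDiff ℝ ∞ v → ContDiff ℝ ∞ W → VectorCalculus.IsDivFree v →
      (∀ x, curl W x = ν • (Δ (curl v)) x - convect v (curl v) x + convect (curl v) v x) →
    ∀ ⦃M B : ℝ⦄, (∀ x, ‖v x‖ ≤ M) → (∀ x, ‖fderiv ℝ v x‖ ≤ B) →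
      (∫⁻ x, ‖iteratedFDeriv ℝ 1 v x‖ₑ ^ 2 < ⊤) → (∫⁻ x, ‖iteratedFDeriv ℝ 2 v x‖ₑ ^ 2 < ⊤) →
      (∫⁻ x, ‖iteratedFDeriv ℝ 3 v x‖ₑ ^ 2 < ⊤) → (∫⁻ x, ‖iteratedFDeriv ℝ 1 W x‖ₑ ^ 2 < ⊤) →
      ∫ x, (‖curl v x‖ ^ 2 + 1) ^ (1 / 4 : ℝ) * ⟪curl v x, curl W x⟫ ≤
        3 / (8 * ν) * ∫ x, ‖v x‖ ^ 2 * ((‖curl v x‖ ^ 2 + 1) ^ (1 / 4 : ℝ) * ‖curl v x‖ ^ 2)) →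
    (∀ ⦃T : ℝ⦄, 0 < T → ∀ ⦃w : ℝ → EuclideanSpace ℝ (Fin 3) → EuclideanSpace ℝ (Fin 3)⦄,
      IsSmoothSpaceTimeOn (Icc 0 T) w →
    ∀ ⦃C₀ C₁ : ℝ≥0⦄ ⦃B : ℝ⦄,
      (∀ t ∈ Icc 0 T, ∫⁻ x, ‖w t x‖ₑ ^ 2 ≤ C₀) →
      (∀ t ∈ Icc 0 T, ∫⁻ x, ‖timeDerivWithin (Icc 0 T) w t x‖ₑ ^ 2 ≤ C₁) →
      (∀ t ∈ Icc 0 T, ∀ x, ‖w t x‖ ≤ B) →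
      IntegrableOn (fun t => ∫ x, 5 / 2 * ((‖w t x‖ ^ 2 + 1) ^ (1 / 4 : ℝ) *
          ⟪w t x, timeDerivWithin (Icc 0 T) w t x⟫)) (Ioo 0 T) ∧
      ContinuousOn (fun t => ∫ x, ((‖w t x‖ ^ 2 + 1) ^ (5 / 4 : ℝ) - 1)) (Icc 0 T) ∧
      ∀ b ∈ Ioc 0 T, ∫ x, ((‖w b x‖ ^ 2 + 1) ^ (5 / 4 : ℝ) - 1) =
        (∫ x, ((‖w 0 x‖ ^ 2 + 1) ^ (5 / 4 : ℝ) - 1)) +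
          ∫ t in (0 : ℝ)..b, ∫ x, 5 / 2 * ((‖w t x‖ ^ 2 + 1) ^ (1 / 4 : ℝ) *
            ⟪w t x, timeDerivWithin (Icc 0 T) w t x⟫)) →
    ∀ ⦃ν T : ℝ⦄, 0 < ν → 0 < T →
    ∀ ⦃u : ℝ → EuclideanSpace ℝ (Fin 3) → EuclideanSpace ℝ (Fin 3)⦄
      ⦃p : ℝ → EuclideanSpace ℝ (Fin 3) → ℝ⦄,
      IsClassicalNSSolutionOn (Icc 0 T) ν 0 u p →
      HasBoundedSobolevNormsOn (Icc 0 T) u →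
      HasBoundedSobolevNormsOn (Icc 0 T) (timeDerivWithin (Icc 0 T) u) →
      (∀ n : ℕ, ∃ C : ℝ≥0, ∀ t ∈ Icc 0 T, ∫⁻ x, ‖iteratedFDeriv ℝ n (p t) x‖ₑ ^ 2 ≤ C) →
    ∀ ⦃s : ℝ⦄, s ∈ Ioc 0 T →
      (∫⁻ t in Ioo 0 s, ENNReal.ofReal ((eLpNorm (u t) ⊤ volume).toReal ^ (2 : ℝ)) ≠ ⊤) →
      ∫⁻ x, ENNReal.ofReal ((‖curl (u s) x‖ ^ 2 + 1) ^ (5 / 4 : ℝ) - 1) ≤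
        ENNReal.ofReal (Real.exp (15 / (16 * ν) *
            (∫⁻ t in Ioo 0 s, ENNReal.ofReal ((eLpNorm (u t) ⊤ volume).toReal ^ (2 : ℝ))).toReal)) *
          ∫⁻ x, ENNReal.ofReal ((‖curl (u 0) x‖ ^ 2 + 1) ^ (5 / 4 : ℝ) - 1) := by
  sorry

/-- **S4 — the slab enstrophy inequality with Lamb-form production.** In Tao's class on
`[0,T] × ℝ³`: `∫|∇u(s)|² ≤ ∫|∇u(0)|² + (2ν)⁻¹ ∫₀ˢ ‖u(t)‖²_{L^{10}} ‖curl u(t)‖²_{L^{5/2}} dt`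
(`s ∈ (0,T]`, in `ℝ≥0∞`). Proof: enstrophy balance (`IsSmoothSpaceTimeOn.enstrophy_balance`);
slice: `∫Σᵢ⟪∂ᵢu,∂ᵢW⟫ = −∫⟪Δu, W⟫ = −ν⁻¹(‖W‖² + ∫⟪(u·∇)u, W⟫ + ∫⟪∇p, W⟫)`
(`integral_sum_inner_fderiv_fderiv_eq_neg_integral_inner_laplacian`, momentum equation), pressure
term `0` (`integral_inner_gradient_eq_zero_of_isDivFree_R3`, `isDivFree_timeDerivWithin`), Lamb
`(u·∇)u = curl u × u + ∇(|u|²/2)` (`convect_self_eq_cross_curl_add_gradient`) whose gradient part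
also integrates to `0` against `W`, pointwise `−(|W|² + ⟪ω×u, W⟫) ≤ |ω|²|u|²/4`, then Hölder
`∫|u|²|ω|² ≤ (∫|u|^{10})^{1/5}(∫|ω|^{5/2})^{4/5}` (`ENNReal.lintegral_mul_le_Lp_mul_Lq`, `p = 5`). -/
theorem stub_enstrophyLambSlab :
    ∀ ⦃ν T : ℝ⦄, 0 < ν → 0 < T →
    ∀ ⦃u : ℝ → EuclideanSpace ℝ (Fin 3) → EuclideanSpace ℝ (Fin 3)⦄
      ⦃p : ℝ → EuclideanSpace ℝ (Fin 3) → ℝ⦄,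
      IsClassicalNSSolutionOn (Icc 0 T) ν 0 u p →
      HasBoundedSobolevNormsOn (Icc 0 T) u →
      HasBoundedSobolevNormsOn (Icc 0 T) (timeDerivWithin (Icc 0 T) u) →
      (∀ n : ℕ, ∃ C : ℝ≥0, ∀ t ∈ Icc 0 T, ∫⁻ x, ‖iteratedFDeriv ℝ n (p t) x‖ₑ ^ 2 ≤ C) →
    ∀ ⦃s : ℝ⦄, s ∈ Ioc 0 T →
      ∫⁻ x, ENNReal.ofReal (frobeniusNormSq (fderiv ℝ (u s) x)) ≤
        (∫⁻ x, ENNReal.ofReal (frobeniusNormSq (fderiv ℝ (u 0) x))) +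
          ENNReal.ofReal ((2 * ν)⁻¹) *
            ∫⁻ t in Ioo 0 s, (∫⁻ x, ‖u t x‖ₑ ^ (10 : ℝ)) ^ (1 / 5 : ℝ) *
              (∫⁻ x, ‖curl (u t) x‖ₑ ^ (5 / 2 : ℝ)) ^ (4 / 5 : ℝ) := by
  sorry

/-- **S5 — Tao-class cover of closed sub-slabs.** A classical solution of the unforced system on
`ℝ³ × [0,T)`, Leray–Hopf from its rapidly decaying datum, is on every closed sub-slab `[0,T']`,
`T' < T`, a classical solution with SOME pressure `q` (the Leray pressure, `= p` up to a function of
time) such that `u`, `∂ₜu`, `q` have all `L²` Sobolev norms bounded (Tao 2013 Thm 5.4 / Cor 11.1).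
Proof: `tao2011_hasBoundedSobolevNormsOn_holds` gives the `u`-bounds on `[0,T'']` (finite energy from
`IsLerayHopfOn.lintegral_enorm_sq_le`); Tao's local solutions `tao2011_smooth_local_existence_holds`
(`IsTaoSolutionOn.of_tao`, uniform lifespan from the uniform `H¹` bound on `[0,T']`) restarted at
`kτ/2` coincide with `u(·+kτ/2)` (`IsClassicalNSSolutionOn.eq_of_hasBoundedSobolevNormsOn` or
`eq_restart_of_serrin`) and glue (`IsTaoSolutionOn.glue`, `.translate`, `.mono`); transfer to `u` by
`IsClassicalNSSolutionOn.congr_slices`, `HasBoundedSobolevNormsOn.congr`, `derivWithin_congr`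
(pattern: `IsHkClassicalSolutionOn.exists_isTaoSolutionOn`, `hasBoundedSobolevNormsOn_restart`). -/
theorem stub_taoCover :
    ∀ ⦃ν T : ℝ⦄, 0 < ν → 0 < T →
    ∀ ⦃u : ℝ → EuclideanSpace ℝ (Fin 3) → EuclideanSpace ℝ (Fin 3)⦄
      ⦃p : ℝ → EuclideanSpace ℝ (Fin 3) → ℝ⦄,
      IsClassicalNSSolutionOn (Ico 0 T) ν 0 u p → IsLerayHopfOn T ν 0 (u 0) u →
      HasRapidSpatialDecay (u 0) →
    ∀ ⦃T' : ℝ⦄, T' ∈ Ioo 0 T →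
      ∃ q : ℝ → EuclideanSpace ℝ (Fin 3) → ℝ,
        IsClassicalNSSolutionOn (Icc 0 T') ν 0 u q ∧
        HasBoundedSobolevNormsOn (Icc 0 T') u ∧
        HasBoundedSobolevNormsOn (Icc 0 T') (timeDerivWithin (Icc 0 T') u) ∧
        (∀ n : ℕ, ∃ C : ℝ≥0, ∀ t ∈ Icc 0 T', ∫⁻ x, ‖iteratedFDeriv ℝ n (q t) x‖ₑ ^ 2 ≤ C) := by
  sorry

/-- **S6 — the `H¹` blow-up rate at a time with no classical extension** (Leray 1934 §20;
Robinson–Rodrigo–Sadowski 2016 Lemma 6.11 / (8.2); here with Tao's lifespan constant): there is a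
universal `c > 0` such that if a classical solution on `ℝ³ × [0,T)`, Leray–Hopf from its rapidly
decaying datum, has NO classical extension past `T`, then `cν³ ≤ (‖u(t)‖₂² + ‖∇u(t)‖₂²)²(T−t)` for
every `t ∈ [0,T)` (in `ℝ≥0∞`). Proof: otherwise pick `T₂ > T − t` with `A²T₂ ≤ cν³`,
`A = ‖u(t)‖₂² + ‖∇u(t)‖₂²`; Tao's local solution `v` from the `H^∞` slice `u t`
(`tao2011_smooth_local_existence_holds`; Sobolev finiteness of `u t` from
`tao2011_hasBoundedSobolevNormsOn_holds` on `[0,t']`, `t < t' < T`) lives on `[0,T₂]` and coincides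
with `u(·+t)` on `[0,T−t)` (`IsClassicalNSSolutionOn.eq_of_hasBoundedSobolevNormsOn` on each
`[0,s]`, or `eq_restart_of_serrin`); so `v` extends `u(·+t)` past `T−t`
(`IsClassicalNSSolutionOn.hasSmoothExtensionPast`) and `HasSmoothExtensionPast.of_translate` (or
`t = 0` directly) contradicts the hypothesis. This is where the energy class is load-bearing
(`rungReynoldsOne_false_without_LerayHopf`: the drifts have `∇u ≡ 0`). -/
theorem stub_h1BlowupRate :
    ∃ c : ℝ, 0 < c ∧ ∀ ⦃ν T : ℝ⦄, 0 < ν → 0 < T →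
    ∀ ⦃u : ℝ → EuclideanSpace ℝ (Fin 3) → EuclideanSpace ℝ (Fin 3)⦄
      ⦃p : ℝ → EuclideanSpace ℝ (Fin 3) → ℝ⦄,
      IsClassicalNSSolutionOn (Ico 0 T) ν 0 u p → IsLerayHopfOn T ν 0 (u 0) u →
      HasRapidSpatialDecay (u 0) → ¬ HasSmoothExtensionPast ν 0 u T →
    ∀ t ∈ Ico 0 T,
      ENNReal.ofReal (c * ν ^ 3) ≤
        ((∫⁻ x, ‖u t x‖ₑ ^ 2) + ∫⁻ x, ENNReal.ofReal (frobeniusNormSq (fderiv ℝ (u t) x))) ^ 2 *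
          ENNReal.ofReal (T - t) := by
  sorry

/-- **S7 — rate bookkeeping (held by the lead).** From the weighted vorticity slab bound (S3's
conclusion), the Lamb-form enstrophy slab inequality (S4) and the Tao cover (S5): along every
classical Leray–Hopf Schwartz-datum solution on `[0,T)` with eventual rate `√(T−t)‖u(t,x)‖ ≤ √ν`,
`‖u(t)‖₂² + ‖∇u(t)‖₂² ≤ K (T−t)^{-9/20}` for all `t` in some `[t₀, T)`. Proof: on `[0,T']` (any
`T' < T`, cover S5) with `N(t) = ‖u(t)‖_∞`: `N ≤ B₀` on `[0,t₀]`, `N² ≤ ν/(T−t)` on `[t₀,T)`, so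
`∫₀ᵗN² ≤ B₀²t₀ + ν log((T−t₀)/(T−t))`; S3 ⇒ `∫F(ω(t)) ≤ K₁(T−t)^{-15/16}`; the sharp `q = 2` slab
inequality (`Target.Negative.lintegral_frobeniusNormSq_le_exp_half_linfty`) ⇒
`∫|∇u(t)|² ≤ K₂(T−t)^{-1/2}`; S4 with `∫|u|^{10} ≤ N⁸... ≤ N⁴∫|u|⁶ ≤ N⁴K_S⁶(∫|∇u|²)³`
(`eLpNorm_six_le_eLpNorm_fderiv_two`) and `∫|ω|^{5/2} ≤ ∫F(ω)` ⇒ integrand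
`≲ (T−s)^{-2/5-3/10-3/4} = (T−s)^{-29/20}`, whose integral from `t₀` is `≲ (T−t)^{-9/20}`; energy
`≤ 2E(u₀)` (`IsLerayHopfOn.lintegral_enorm_sq_le`). -/
theorem stub_rateBookkeeping :
    (∀ ⦃ν T : ℝ⦄, 0 < ν → 0 < T →
    ∀ ⦃u : ℝ → EuclideanSpace ℝ (Fin 3) → EuclideanSpace ℝ (Fin 3)⦄
      ⦃p : ℝ → EuclideanSpace ℝ (Fin 3) → ℝ⦄,
      IsClassicalNSSolutionOn (Icc 0 T) ν 0 u p →
      HasBoundedSobolevNormsOn (Icc 0 T) u →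
      HasBoundedSobolevNormsOn (Icc 0 T) (timeDerivWithin (Icc 0 T) u) →
      (∀ n : ℕ, ∃ C : ℝ≥0, ∀ t ∈ Icc 0 T, ∫⁻ x, ‖iteratedFDeriv ℝ n (p t) x‖ₑ ^ 2 ≤ C) →
    ∀ ⦃s : ℝ⦄, s ∈ Ioc 0 T →
      (∫⁻ t in Ioo 0 s, ENNReal.ofReal ((eLpNorm (u t) ⊤ volume).toReal ^ (2 : ℝ)) ≠ ⊤) →
      ∫⁻ x, ENNReal.ofReal ((‖curl (u s) x‖ ^ 2 + 1) ^ (5 / 4 : ℝ) - 1) ≤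
        ENNReal.ofReal (Real.exp (15 / (16 * ν) *
            (∫⁻ t in Ioo 0 s, ENNReal.ofReal ((eLpNorm (u t) ⊤ volume).toReal ^ (2 : ℝ))).toReal)) *
          ∫⁻ x, ENNReal.ofReal ((‖curl (u 0) x‖ ^ 2 + 1) ^ (5 / 4 : ℝ) - 1)) →
    (∀ ⦃ν T : ℝ⦄, 0 < ν → 0 < T →
    ∀ ⦃u : ℝ → EuclideanSpace ℝ (Fin 3) → EuclideanSpace ℝ (Fin 3)⦄
      ⦃p : ℝ → EuclideanSpace ℝ (Fin 3) → ℝ⦄,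
      IsClassicalNSSolutionOn (Icc 0 T) ν 0 u p →
      HasBoundedSobolevNormsOn (Icc 0 T) u →
      HasBoundedSobolevNormsOn (Icc 0 T) (timeDerivWithin (Icc 0 T) u) →
      (∀ n : ℕ, ∃ C : ℝ≥0, ∀ t ∈ Icc 0 T, ∫⁻ x, ‖iteratedFDeriv ℝ n (p t) x‖ₑ ^ 2 ≤ C) →
    ∀ ⦃s : ℝ⦄, s ∈ Ioc 0 T →
      ∫⁻ x, ENNReal.ofReal (frobeniusNormSq (fderiv ℝ (u s) x)) ≤
        (∫⁻ x, ENNReal.ofReal (frobeniusNormSq (fderiv ℝ (u 0) x))) +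
          ENNReal.ofReal ((2 * ν)⁻¹) *
            ∫⁻ t in Ioo 0 s, (∫⁻ x, ‖u t x‖ₑ ^ (10 : ℝ)) ^ (1 / 5 : ℝ) *
              (∫⁻ x, ‖curl (u t) x‖ₑ ^ (5 / 2 : ℝ)) ^ (4 / 5 : ℝ)) →
    (∀ ⦃ν T : ℝ⦄, 0 < ν → 0 < T →
    ∀ ⦃u : ℝ → EuclideanSpace ℝ (Fin 3) → EuclideanSpace ℝ (Fin 3)⦄
      ⦃p : ℝ → EuclideanSpace ℝ (Fin 3) → ℝ⦄,
      IsClassicalNSSolutionOn (Ico 0 T) ν 0 u p → IsLerayHopfOn T ν 0 (u 0) u →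
      HasRapidSpatialDecay (u 0) →
    ∀ ⦃T' : ℝ⦄, T' ∈ Ioo 0 T →
      ∃ q : ℝ → EuclideanSpace ℝ (Fin 3) → ℝ,
        IsClassicalNSSolutionOn (Icc 0 T') ν 0 u q ∧
        HasBoundedSobolevNormsOn (Icc 0 T') u ∧
        HasBoundedSobolevNormsOn (Icc 0 T') (timeDerivWithin (Icc 0 T') u) ∧
        (∀ n : ℕ, ∃ C : ℝ≥0, ∀ t ∈ Icc 0 T', ∫⁻ x, ‖iteratedFDeriv ℝ n (q t) x‖ₑ ^ 2 ≤ C)) →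
    ∀ ⦃ν T : ℝ⦄, 0 < ν → 0 < T →
    ∀ ⦃u : ℝ → EuclideanSpace ℝ (Fin 3) → EuclideanSpace ℝ (Fin 3)⦄
      ⦃p : ℝ → EuclideanSpace ℝ (Fin 3) → ℝ⦄,
      IsClassicalNSSolutionOn (Ico 0 T) ν 0 u p → IsLerayHopfOn T ν 0 (u 0) u →
      HasRapidSpatialDecay (u 0) →
      (∀ᶠ t in 𝓝[<] T, ∀ x, Real.sqrt (T - t) * ‖u t x‖ ≤ Real.sqrt ν) →
      ∃ K : ℝ, ∃ t₀ ∈ Ico 0 T, ∀ t ∈ Ico t₀ T,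
        (∫⁻ x, ‖u t x‖ₑ ^ 2) + ∫⁻ x, ENNReal.ofReal (frobeniusNormSq (fderiv ℝ (u t) x)) ≤
          ENNReal.ofReal (K * (T - t) ^ (-(9 / 20 : ℝ))) := by
  sorry

/-! ## Bookkeeping lemmas (proved) -/

/-- Exponent arithmetic: `(K x^{-γ})² · x = K² x^{1 − 2γ}` for `x > 0`. -/
theorem sq_mul_rpow_neg_mul {x : ℝ} (hx : 0 < x) (K γ : ℝ) :
    (K * x ^ (-γ)) ^ 2 * x = K ^ 2 * x ^ (1 - 2 * γ) := by
  have h1 : (x ^ (-γ)) ^ 2 = x ^ (-γ * 2) := by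
    rw [← Real.rpow_two, ← Real.rpow_mul hx.le]
  have h2 : x ^ (-γ * 2) * x = x ^ (1 - 2 * γ) := by
    conv_lhs => rw [← Real.rpow_one x, ← Real.rpow_mul hx.le, ← Real.rpow_add hx]
    congr 1
    ring
  rw [mul_pow, h1, mul_assoc, h2]

/-- `K² (T − t)^{1−2γ} → 0` as `t ↑ T` when `γ < 1/2`. -/
theorem tendsto_sq_mul_rpow_sub {T K γ : ℝ} (hγ : γ < 1 / 2) :
    Tendsto (fun t : ℝ => K ^ 2 * (T - t) ^ (1 - 2 * γ)) (𝓝[<] T) (𝓝 0) := by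
  have hpos : 0 < 1 - 2 * γ := by linarith
  have h1 : Tendsto (fun t : ℝ => T - t) (𝓝[<] T) (𝓝 0) := by
    have h : Tendsto (fun t : ℝ => T - t) (𝓝 T) (𝓝 (T - T)) :=
      tendsto_const_nhds.sub tendsto_id
    rw [sub_self] at h
    exact h.mono_left nhdsWithin_le_nhds
  have h2 : Tendsto (fun t : ℝ => (T - t) ^ (1 - 2 * γ)) (𝓝[<] T) (𝓝 0) := by
    have h := h1.rpow_const (p := 1 - 2 * γ) (Or.inr hpos.le)
    rwa [Real.zero_rpow hpos.ne'] at h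
  simpa using h2.const_mul (K ^ 2)

/-! ## The composition -/

/-- **Subcritical enstrophy decay plus the `H¹` blow-up rate close rung one.** If along every
rate-one solution `‖u(t)‖₂² + ‖∇u(t)‖₂² ≤ K(T−t)^{-γ}` near `T` with `γ = 9/20 < 1/2` (the
conclusion of S7) and a singular time forces `cν³ ≤ (‖u(t)‖₂²+‖∇u(t)‖₂²)²(T−t)` (S6), then every
rate-one solution extends: otherwise `cν³ ≤ K²(T−t)^{1/10} → 0`. -/
theorem rung_one_of_decay_of_rate
    (hdecay : ∀ ⦃ν T : ℝ⦄, 0 < ν → 0 < T →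
      ∀ ⦃u : ℝ → EuclideanSpace ℝ (Fin 3) → EuclideanSpace ℝ (Fin 3)⦄
        ⦃p : ℝ → EuclideanSpace ℝ (Fin 3) → ℝ⦄,
        IsClassicalNSSolutionOn (Ico 0 T) ν 0 u p → IsLerayHopfOn T ν 0 (u 0) u →
        HasRapidSpatialDecay (u 0) →
        (∀ᶠ t in 𝓝[<] T, ∀ x, Real.sqrt (T - t) * ‖u t x‖ ≤ Real.sqrt ν) →
        ∃ K : ℝ, ∃ t₀ ∈ Ico 0 T, ∀ t ∈ Ico t₀ T,
          (∫⁻ x, ‖u t x‖ₑ ^ 2) + ∫⁻ x, ENNReal.ofReal (frobeniusNormSq (fderiv ℝ (u t) x)) ≤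
            ENNReal.ofReal (K * (T - t) ^ (-(9 / 20 : ℝ))))
    (hrate : ∃ c : ℝ, 0 < c ∧ ∀ ⦃ν T : ℝ⦄, 0 < ν → 0 < T →
      ∀ ⦃u : ℝ → EuclideanSpace ℝ (Fin 3) → EuclideanSpace ℝ (Fin 3)⦄
        ⦃p : ℝ → EuclideanSpace ℝ (Fin 3) → ℝ⦄,
        IsClassicalNSSolutionOn (Ico 0 T) ν 0 u p → IsLerayHopfOn T ν 0 (u 0) u →
        HasRapidSpatialDecay (u 0) → ¬ HasSmoothExtensionPast ν 0 u T →
      ∀ t ∈ Ico 0 T,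
        ENNReal.ofReal (c * ν ^ 3) ≤
          ((∫⁻ x, ‖u t x‖ₑ ^ 2) + ∫⁻ x, ENNReal.ofReal (frobeniusNormSq (fderiv ℝ (u t) x))) ^ 2 *
            ENNReal.ofReal (T - t)) :
    Rung 1 := by
  intro ν T hν hT u p hcl hLH hdec hrate1
  by_contra hext
  have hrate1' : ∀ᶠ t in 𝓝[<] T, ∀ x, Real.sqrt (T - t) * ‖u t x‖ ≤ Real.sqrt ν := by
    simpa only [one_mul] using hrate1
  obtain ⟨K, t₀, ht₀, hK⟩ := hdecay hν hT hcl hLH hdec hrate1'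
  obtain ⟨c, hc, hlow⟩ := hrate
  have hlow' := hlow hν hT hcl hLH hdec hext
  have hcν : 0 < c * ν ^ 3 := mul_pos hc (pow_pos hν 3)
  -- the exponent `γ = 9/20 < 1/2`
  have hγ : (9 / 20 : ℝ) < 1 / 2 := by norm_num
  -- eventually `K² (T − t)^{1 − 2γ} < c ν³`
  have hsmall : ∀ᶠ t in 𝓝[<] T, K ^ 2 * (T - t) ^ (1 - 2 * (9 / 20 : ℝ)) < c * ν ^ 3 :=
    (tendsto_order.1 (tendsto_sq_mul_rpow_sub (T := T) (K := K) hγ)).2 _ hcν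
  -- a time `t ∈ [t₀, T)` where this holds
  have hIco : ∀ᶠ t in 𝓝[<] T, t ∈ Ico t₀ T := Ico_mem_nhdsLT ht₀.2
  obtain ⟨t, ht, hsmallt⟩ := (hIco.and hsmall).exists
  have htT : t ∈ Ico 0 T := ⟨ht₀.1.trans ht.1, ht.2⟩
  have hTt : 0 < T - t := sub_pos.2 ht.2
  have hup := hK t ht
  have hlo := hlow' t htT
  -- `K ≥ 0` may fail; but the bound `ofReal (K x^{-γ})` is then `0`, still fine via `max K 0`?
  -- We argue directly in `ℝ≥0∞`.
  have hnn : 0 ≤ max K 0 * (T - t) ^ (-(9 / 20 : ℝ)) :=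
    mul_nonneg (le_max_right _ _) (Real.rpow_nonneg hTt.le _)
  have hup' : (∫⁻ x, ‖u t x‖ₑ ^ 2) + ∫⁻ x, ENNReal.ofReal (frobeniusNormSq (fderiv ℝ (u t) x)) ≤
      ENNReal.ofReal (max K 0 * (T - t) ^ (-(9 / 20 : ℝ))) := by
    refine hup.trans (ENNReal.ofReal_le_ofReal ?_)
    exact mul_le_mul_of_nonneg_right (le_max_left _ _) (Real.rpow_nonneg hTt.le _)
  have hchain : ENNReal.ofReal (c * ν ^ 3) ≤
      ENNReal.ofReal ((max K 0) ^ 2 * (T - t) ^ (1 - 2 * (9 / 20 : ℝ))) := by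
    calc ENNReal.ofReal (c * ν ^ 3)
        ≤ ((∫⁻ x, ‖u t x‖ₑ ^ 2) + ∫⁻ x, ENNReal.ofReal (frobeniusNormSq (fderiv ℝ (u t) x))) ^ 2 *
            ENNReal.ofReal (T - t) := hlo
      _ ≤ (ENNReal.ofReal (max K 0 * (T - t) ^ (-(9 / 20 : ℝ)))) ^ 2 * ENNReal.ofReal (T - t) := by
          gcongr
      _ = ENNReal.ofReal ((max K 0 * (T - t) ^ (-(9 / 20 : ℝ))) ^ 2 * (T - t)) := by
          rw [ENNReal.ofReal_mul (sq_nonneg _), ENNReal.ofReal_pow hnn]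
      _ = ENNReal.ofReal ((max K 0) ^ 2 * (T - t) ^ (1 - 2 * (9 / 20 : ℝ))) := by
          rw [sq_mul_rpow_neg_mul hTt]
  have hnn' : 0 ≤ (max K 0) ^ 2 * (T - t) ^ (1 - 2 * (9 / 20 : ℝ)) :=
    mul_nonneg (sq_nonneg _) (Real.rpow_nonneg hTt.le _)
  have h1 := (ENNReal.ofReal_le_ofReal_iff hnn').1 hchain
  have h2 : (max K 0) ^ 2 ≤ K ^ 2 := by
    rcases le_total K 0 with hK0 | hK0
    · rw [max_eq_right hK0]; simpa using sq_nonneg K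
    · rw [max_eq_left hK0]
  have h3 : (max K 0) ^ 2 * (T - t) ^ (1 - 2 * (9 / 20 : ℝ)) ≤
      K ^ 2 * (T - t) ^ (1 - 2 * (9 / 20 : ℝ)) :=
    mul_le_mul_of_nonneg_right h2 (Real.rpow_nonneg hTt.le _)
  linarith

/-- **The composition (kernel-checked), concluding the crux decl BY NAME**: the seven registered
stubs plugged into `rung_one_of_decay_of_rate` (`Rung 1 ↔ RungReynoldsOne` by `rung_one_iff`).
No `sorry` of its own; its closure is the crux proof as soon as the stubs are proved with these
exact statements. -/
theorem RungReynoldsOne_of : RungReynoldsOne :=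
  rung_one_iff.1 (rung_one_of_decay_of_rate
    (stub_rateBookkeeping
      (stub_weightedVorticitySlab stub_weightedVorticitySlice stub_weightedVorticityBalance)
      stub_enstrophyLambSlab stub_taoCover)
    stub_h1BlowupRate)

end Summit.NavierStokesRegularity.NavierStokesRegularity.Cruxes.RungReynoldsOne.LpVorticityYoungBudget

end
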